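import Mathlib

/-!
# Crux `DlogGraphFlat` (stmt-QuantumAdvantage-10732), line `Sketch_holder_energy` — transfer average

Dyadic averages of Riesz-product moduli.  For signs `σ : ℕ → Bool` put
`w_i(t) = ‖1 + s_i e(t)‖` (`s_i = ∓1`, `e(t) = exp(2πit)`), a `1`-periodic weight with values
in `[0, 2]`, and `avg_m(φ) = ∑_{r<2^m} ∏_{i<m} w_i(2^i (φ+r)/2^m)`.  Assuming the two-scale bound
`∑_{r<4} w_a((φ+r)/2) w_{a'}((φ+r)/4) ≤ 4 √(2+√2)` (the neighbouring stub `stub_heTwoStep`, taken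
as a hypothesis), the registered stub `stub_heTransferAvg` asserts
`avg_m(φ) ≤ 2 · 2^m · (2+√2)^{m/4}`.

Proof: peel the two top scales.  Writing `r = 4q + j` (`j < 4`, `q < 2^m`) and using
`1`-periodicity, `avg_{m+2}(φ) = ∑_{j<4} w_{m+1}((φ+j)/2) w_m((φ+j)/4) avg_m((φ+j)/4)`
(`heTransferAvg_twoStep_identity`), so `sup avg_{m+2} ≤ 4 √(2+√2) · sup avg_m`; a two-step
induction (`heTransferAvg_abstract`, bases `avg_0 = 1`, `avg_1 ≤ 4`) against the sequence
`B m = 2 · 2^m · (2+√2)^{m/4}` (which satisfies `B (m+2) = 4 √(2+√2) B m`) concludes.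
No new definitions; the weights enter only through an abstract family `W : ℕ → ℝ → ℝ`.
-/

set_option linter.dupNamespace false -- D-0017: single-problem summit ⇒ `QuantumAdvantage.QuantumAdvantage` by design

namespace Summit.QuantumAdvantage.QuantumAdvantage.Theorems.SymplecticPurity

open Finset

section HeTransferAvg

/-- Splitting a sum over `range (k * n)` into `n` consecutive blocks of length `k`. -/
theorem heTransferAvg_sum_range_mul (f : ℕ → ℝ) (k n : ℕ) :
    ∑ r ∈ range (k * n), f r = ∑ q ∈ range n, ∑ j ∈ range k, f (k * q + j) := by
  induction n with
  | zero => simp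
  | succ n ih =>
    rw [show k * (n + 1) = k * n + k by ring, sum_range_add, ih, sum_range_succ]

/-- A family of `1`-periodic functions is `n`-periodic for every natural number `n`. -/
theorem heTransferAvg_periodic_nat (W : ℕ → ℝ → ℝ) (hper : ∀ i t, W i (t + 1) = W i t)
    (i : ℕ) (t : ℝ) (n : ℕ) : W i (t + n) = W i t := by
  induction n with
  | zero => simp
  | succ n ih => rw [Nat.cast_succ, ← add_assoc, hper, ih]

/-- Peeling the two top scales: splitting `r = 4 q + j`, the level-`m+2` dyadic average is a
four-term combination of level-`m` dyadic averages at the shifted phases `(φ + j) / 4`. -/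
theorem heTransferAvg_twoStep_identity (W : ℕ → ℝ → ℝ) (hper : ∀ i t, W i (t + 1) = W i t)
    (m : ℕ) (φ : ℝ) :
    ∑ r ∈ range (2 ^ (m + 2)), ∏ i ∈ range (m + 2), W i (2 ^ i * ((φ + r) / 2 ^ (m + 2)))
      = ∑ j ∈ range 4, W (m + 1) ((φ + j) / 2) * W m ((φ + j) / 4) *
          ∑ q ∈ range (2 ^ m), ∏ i ∈ range m, W i (2 ^ i * (((φ + j) / 4 + q) / 2 ^ m)) := by
  have h4 : (2 : ℕ) ^ (m + 2) = 4 * 2 ^ m := by rw [pow_add]; ring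
  rw [h4, heTransferAvg_sum_range_mul, sum_comm]
  refine sum_congr rfl (fun j _ => ?_)
  rw [mul_sum]
  refine sum_congr rfl (fun q _ => ?_)
  have ha : ∀ i : ℕ, (2 : ℝ) ^ i * ((φ + ((4 * q + j : ℕ) : ℝ)) / 2 ^ (m + 2)) =
      2 ^ i * (((φ + (j : ℝ)) / 4 + (q : ℝ)) / 2 ^ m) := by
    intro i; push_cast; field_simp; ring
  have hb : (2 : ℝ) ^ m * ((φ + ((4 * q + j : ℕ) : ℝ)) / 2 ^ (m + 2)) =
      (φ + (j : ℝ)) / 4 + (q : ℝ) := by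
    push_cast; field_simp; ring
  have hc : (2 : ℝ) ^ (m + 1) * ((φ + ((4 * q + j : ℕ) : ℝ)) / 2 ^ (m + 2)) =
      (φ + (j : ℝ)) / 2 + ((2 * q : ℕ) : ℝ) := by
    push_cast; field_simp; ring
  have hprod : ∏ i ∈ range m, W i (2 ^ i * ((φ + ((4 * q + j : ℕ) : ℝ)) / 2 ^ (m + 2))) =
      ∏ i ∈ range m, W i (2 ^ i * (((φ + (j : ℝ)) / 4 + (q : ℝ)) / 2 ^ m)) :=
    prod_congr rfl (fun i _ => by rw [ha i])
  rw [prod_range_succ, prod_range_succ, hb, hc, heTransferAvg_periodic_nat W hper,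
    heTransferAvg_periodic_nat W hper, hprod]
  ring

/-- Abstract two-step induction: dyadic averages of products of `1`-periodic weights with values
in `[0, 2]` obeying a two-scale bound with constant `4 C` are dominated by any sequence `B` with
`1 ≤ B 0`, `4 ≤ B 1` and `4 C · B m ≤ B (m + 2)`. -/
theorem heTransferAvg_abstract (W : ℕ → ℝ → ℝ) (C : ℝ) (B : ℕ → ℝ)
    (hper : ∀ i t, W i (t + 1) = W i t)
    (hnn : ∀ i t, 0 ≤ W i t) (hle : ∀ i t, W i t ≤ 2)
    (hC : ∀ (i j : ℕ) (φ : ℝ),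
      ∑ r ∈ range 4, W i ((φ + r) / 2) * W j ((φ + r) / 4) ≤ 4 * C)
    (hB0 : 1 ≤ B 0) (hB1 : 4 ≤ B 1) (hB : ∀ m, 4 * C * B m ≤ B (m + 2)) (m : ℕ) (φ : ℝ) :
    ∑ r ∈ range (2 ^ m), ∏ i ∈ range m, W i (2 ^ i * ((φ + r) / 2 ^ m)) ≤ B m := by
  induction m using Nat.strong_induction_on generalizing φ with
  | h m ih =>
    rcases m with _ | _ | m
    · simpa using hB0
    · calc ∑ r ∈ range (2 ^ (0 + 1)), ∏ i ∈ range (0 + 1), W i (2 ^ i * ((φ + r) / 2 ^ (0 + 1)))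
            ≤ ∑ r ∈ range (2 ^ (0 + 1)), (2 : ℝ) := sum_le_sum fun r _ => by
              rw [zero_add, prod_range_one]; exact hle _ _
        _ = 4 := by rw [sum_const, card_range, nsmul_eq_mul]; norm_num
        _ ≤ B (0 + 1) := hB1
    · have ih' : ∀ ψ : ℝ,
          ∑ r ∈ range (2 ^ m), ∏ i ∈ range m, W i (2 ^ i * ((ψ + r) / 2 ^ m)) ≤ B m :=
        fun ψ => ih m (by omega) ψ
      have hBm : 0 ≤ B m :=
        le_trans (sum_nonneg fun r _ => prod_nonneg fun i _ => hnn _ _) (ih' 0)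
      rw [show m + 1 + 1 = m + 2 from rfl, heTransferAvg_twoStep_identity W hper m φ]
      calc ∑ j ∈ range 4, W (m + 1) ((φ + j) / 2) * W m ((φ + j) / 4) *
              ∑ q ∈ range (2 ^ m), ∏ i ∈ range m, W i (2 ^ i * (((φ + j) / 4 + q) / 2 ^ m))
          ≤ ∑ j ∈ range 4, W (m + 1) ((φ + j) / 2) * W m ((φ + j) / 4) * B m :=
            sum_le_sum fun j _ =>
              mul_le_mul_of_nonneg_left (ih' _) (mul_nonneg (hnn _ _) (hnn _ _))
        _ = (∑ j ∈ range 4, W (m + 1) ((φ + j) / 2) * W m ((φ + j) / 4)) * B m := by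
            rw [sum_mul]
        _ ≤ 4 * C * B m := mul_le_mul_of_nonneg_right (hC _ _ _) hBm
        _ ≤ B (m + 2) := hB m

end HeTransferAvg

/-- **Registered stub `stub_heTransferAvg`** (line `Sketch_holder_energy` of `DlogGraphFlat`).
Given the two-scale transfer bound `∑_{r<4} w_a((φ+r)/2) w_{a'}((φ+r)/4) ≤ 4 √(2+√2)` for the
Riesz-product moduli `w_a(t) = ‖1 ∓ e(t)‖`, the dyadic averages
`∑_{r<2^m} ∏_{i<m} w_{σ i}(2^i (φ+r)/2^m)` are at most `2 · 2^m · (2+√2)^{m/4}`. -/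
theorem stub_heTransferAvg : (∀ (a a' : Bool) (φ : ℝ), ∑ r ∈ Finset.range 4, ‖(1 : ℂ) + (if a then -1 else 1) * Complex.exp (2 * Real.pi * Complex.I * (((φ + (r : ℝ)) / 2 : ℝ) : ℂ))‖ * ‖(1 : ℂ) + (if a' then -1 else 1) * Complex.exp (2 * Real.pi * Complex.I * (((φ + (r : ℝ)) / 4 : ℝ) : ℂ))‖ ≤ 4 * Real.sqrt (2 + Real.sqrt 2)) → ∀ (m : ℕ) (σ : ℕ → Bool) (φ : ℝ), ∑ r ∈ Finset.range (2 ^ m), ∏ i ∈ Finset.range m, ‖(1 : ℂ) + (if σ i then -1 else 1) * Complex.exp (2 * Real.pi * Complex.I * (((2 : ℝ) ^ i * ((φ + (r : ℝ)) / (2 : ℝ) ^ m) : ℝ) : ℂ))‖ ≤ 2 * (2 : ℝ) ^ m * (2 + Real.sqrt 2) ^ ((m : ℝ) / 4) := by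
  intro H m σ φ
  -- the phase `e(t)` is unimodular
  have hexp : ∀ t : ℝ, ‖Complex.exp (2 * Real.pi * Complex.I * (t : ℂ))‖ = 1 := by
    intro t
    rw [show (2 * Real.pi * Complex.I * (t : ℂ)) = ((2 * Real.pi * t : ℝ) : ℂ) * Complex.I by
      push_cast; ring]
    exact Complex.norm_exp_ofReal_mul_I _
  -- `1`-periodicity of the weights
  have hper : ∀ (i : ℕ) (t : ℝ),
      ‖(1 : ℂ) + (if σ i then -1 else 1) * Complex.exp (2 * Real.pi * Complex.I * ((t + 1 : ℝ) : ℂ))‖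
        = ‖(1 : ℂ) + (if σ i then -1 else 1) * Complex.exp (2 * Real.pi * Complex.I * (t : ℂ))‖ := by
    intro i t
    have he : Complex.exp (2 * Real.pi * Complex.I * ((t + 1 : ℝ) : ℂ))
        = Complex.exp (2 * Real.pi * Complex.I * (t : ℂ)) := by
      push_cast
      rw [mul_add, mul_one, Complex.exp_add, Complex.exp_two_pi_mul_I, mul_one]
    rw [he]
  -- the weights take values in `[0, 2]`
  have hle : ∀ (i : ℕ) (t : ℝ),
      ‖(1 : ℂ) + (if σ i then -1 else 1) * Complex.exp (2 * Real.pi * Complex.I * (t : ℂ))‖ ≤ 2 := by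
    intro i t
    have hs : ‖(if σ i then -1 else 1 : ℂ)‖ = 1 := by split_ifs <;> simp
    calc ‖(1 : ℂ) + (if σ i then -1 else 1) * Complex.exp (2 * Real.pi * Complex.I * (t : ℂ))‖
        ≤ ‖(1 : ℂ)‖ + ‖(if σ i then -1 else 1 : ℂ) * Complex.exp (2 * Real.pi * Complex.I * (t : ℂ))‖ :=
          norm_add_le _ _
      _ = 2 := by rw [norm_mul, hs, hexp, norm_one]; norm_num
  -- the comparison sequence `B m = 2 · 2^m · (2+√2)^{m/4}`
  have hS : (0 : ℝ) < 2 + Real.sqrt 2 := by positivity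
  have hB : ∀ n : ℕ, 4 * Real.sqrt (2 + Real.sqrt 2) * (2 * (2 : ℝ) ^ n * (2 + Real.sqrt 2) ^ ((n : ℝ) / 4))
      ≤ 2 * (2 : ℝ) ^ (n + 2) * (2 + Real.sqrt 2) ^ (((n + 2 : ℕ) : ℝ) / 4) := by
    intro n
    have h1 : (2 + Real.sqrt 2) ^ (((n + 2 : ℕ) : ℝ) / 4) =
        (2 + Real.sqrt 2) ^ ((n : ℝ) / 4) * Real.sqrt (2 + Real.sqrt 2) := by
      rw [Real.sqrt_eq_rpow (2 + Real.sqrt 2), ← Real.rpow_add hS]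
      congr 1; push_cast; ring
    rw [h1, pow_add]
    apply le_of_eq
    ring
  have hB0 : (1 : ℝ) ≤ 2 * (2 : ℝ) ^ 0 * (2 + Real.sqrt 2) ^ (((0 : ℕ) : ℝ) / 4) := by norm_num
  have hB1 : (4 : ℝ) ≤ 2 * (2 : ℝ) ^ 1 * (2 + Real.sqrt 2) ^ (((1 : ℕ) : ℝ) / 4) := by
    have h1 : (1 : ℝ) ≤ (2 + Real.sqrt 2) ^ (((1 : ℕ) : ℝ) / 4) :=
      Real.one_le_rpow (by linarith [Real.sqrt_nonneg 2]) (by positivity)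
    linarith
  exact heTransferAvg_abstract
    (fun (i : ℕ) (t : ℝ) =>
      ‖(1 : ℂ) + (if σ i then -1 else 1) * Complex.exp (2 * Real.pi * Complex.I * (t : ℂ))‖)
    (Real.sqrt (2 + Real.sqrt 2)) (fun n : ℕ => 2 * (2 : ℝ) ^ n * (2 + Real.sqrt 2) ^ ((n : ℝ) / 4))
    hper (fun i t => norm_nonneg _) hle (fun i j ψ => H (σ i) (σ j) ψ) hB0 hB1 hB m φ

end Summit.QuantumAdvantage.QuantumAdvantage.Theorems.SymplecticPurity
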